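import Literature.NumberTheory.EllipticCurves.HeegnerPointsKolyvaginTorsionProofs
import HarnessLib

/-!
# Route `AdditiveKolyvaginRoad`, crux `LevelKolyvaginSystemsAdditive` (item stmt-BirchSwinnertonDyer-21396, KS′):
# SCHUR FOR THE MOD-`p` REPRESENTATION RESTRICTED TO A QUADRATIC FIELD — brick B2d of the K-half of stub `stub_kummerLineAtP`
# of line `epsilon_matched_retyping` (cell `pub/bsd-wall`, width seat `bsd-wall-akr-p2x-w2` g4; `--supports stmt-BirchSwinnertonDyer-21396`,
# helper; namespace `…Theorems.AdditiveKoly.KummerDescent`)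

WHY. The registered stub `stub_kummerLineAtP` quantifies over EVERY `Γ_K`-equivariant isomorphism `θ : E₀[p](K̄) ≃ E[p](K̄)`,
while bricks B2a–B2c (`…KummerDescent{BaseField,Transfer,SplitPrime}`) settle it for the transferred one `T_E ∘ e ∘ T_{E₀}⁻¹`.
The gap is Schur's lemma: under the stub's hypothesis `ρ̄_{E,p} : Γ_ℚ ↠ Aut(E[p])` (and `[K : ℚ] = 2`, `p` odd) any two such `θ`
differ by a unit scalar. This file proves the group theory: an additive endomorphism of `E[p](ℚ̄)` commuting with the action of
`Γ_K` (through `Γ_K → Γ_ℚ`) is a scalar. Road (no basis chosen): the squares of `Γ_ℚ` restrict from `Γ_K` (tree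
`exists_resGal_eq_mul_self`), so `α` commutes with `g²` for every `g ∈ Aut(E[p])` (`ρ̄` onto); if some `α Q ∉ 𝔽_p Q`, the transvection
`g = 1 + λ(·) Q` with `λ(Q) = 0`, `λ(α Q) = 1` has `g² Q = Q`, `g²(α Q) = α Q + 2Q`, contradicting `α g² = g² α` for `p` odd; and an
endomorphism all of whose vectors are eigenvectors is a scalar.

WHAT.
* §1 (an `𝔽_p`-module `M`, `p` odd): `map_zmod_smul`; `forall_exists_eq_smul_of_comm_sq` (commuting with all squares of
  automorphisms ⟹ every vector is an eigenvector); `exists_forall_eq_smul_of_forall_exists` (⟹ scalar).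
* §2 **`exists_forall_eq_smul_of_resGal_comm`** — `W/ℚ` elliptic, `[K : ℚ] = 2`, `p` odd, `ρ̄_{W,n}` onto with `#W[n] = p²` and
  `p · W[n] = 0` (`n = p` up to spelling): every additive endomorphism of `W[n](ℚ̄)` commuting with `res(Γ_K)` is `a • id`, `a : ℕ`.

HONEST FRAMING: theorems only; 0 definitions, 0 named facts, 0 `sorry`; finite group theory / linear algebra over `𝔽_p` plus the
tree's `exists_resGal_eq_mul_self`. Closes nothing by itself; BSD is not proved by any of this.

References: [cite: Serre1972, §4 (image of ρ̄)] [cite: SerreGaloisCohomology1997, II §1.1] [cite: SilvermanAEC2009, III.§7].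
-/

-- single-conjunct summit: `Summit.BirchSwinnertonDyer.BirchSwinnertonDyer.…` repeats the name by design
set_option linter.dupNamespace false
set_option autoImplicit false

noncomputable section

open scoped Classical

namespace Summit.BirchSwinnertonDyer.BirchSwinnertonDyer.Theorems.AdditiveKoly.KummerDescent

open WeierstrassCurve Field
  Literature.NumberTheory.EllipticCurves Literature.NumberTheory.GaloisRepresentations

/-! ## §1 Linear algebra over `𝔽_p`: commuting with all squares of automorphisms forces a scalar -/

section LinearAlgebra

variable {p : ℕ} [hp : Fact p.Prime] {M : Type*} [AddCommGroup M] [Module (ZMod p) M]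

/-- An additive endomorphism of an `𝔽_p`-module is `𝔽_p`-linear. [folklore] -/
theorem map_zmod_smul (α : M →+ M) (d : ZMod p) (x : M) : α (d • x) = d • α x := by
  rw [← ZMod.natCast_zmod_val d, Nat.cast_smul_eq_nsmul, map_nsmul, Nat.cast_smul_eq_nsmul]

/-- **Commuting with all squares of automorphisms makes every vector an eigenvector** (`p` odd): if `α g² = g² α` for every
additive automorphism `g` of the `𝔽_p`-module `M`, then `α Q ∈ 𝔽_p Q` for every `Q` — otherwise the transvection
`g = 1 + λ(·) Q` with `λ Q = 0`, `λ (α Q) = 1` gives `g² Q = Q` but `g² (α Q) = α Q + 2 Q`. [folklore] -/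
theorem forall_exists_eq_smul_of_comm_sq (hp2 : p ≠ 2) (α : M →+ M)
    (hcomm : ∀ (g : M ≃+ M) (m : M), α (g (g m)) = g (g (α m))) (Q : M) : ∃ a : ZMod p, α Q = a • Q := by
  by_contra hQ
  -- a functional vanishing on `Q` and equal to `1` on `α Q`
  let S : Submodule (ZMod p) M := (ZMod p) ∙ Q
  have hαQ : S.mkQ (α Q) ≠ 0 := by
    intro h0
    rw [Submodule.mkQ_apply, Submodule.Quotient.mk_eq_zero, Submodule.mem_span_singleton] at h0
    obtain ⟨a, ha⟩ := h0
    exact hQ ⟨a, ha.symm⟩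
  obtain ⟨f, hf⟩ := Module.Projective.exists_dual_eq_one (ZMod p) hαQ
  let lam : M →ₗ[ZMod p] ZMod p := f ∘ₗ S.mkQ
  have hlamQ : lam Q = 0 := by
    change f (S.mkQ Q) = 0
    rw [Submodule.mkQ_apply, (Submodule.Quotient.mk_eq_zero S).mpr (Submodule.mem_span_singleton_self Q), map_zero]
  have hlamαQ : lam (α Q) = 1 := hf
  -- the transvection `g = 1 + lam(·) Q`
  let φ : M →ₗ[ZMod p] M := lam.smulRight Q
  have hφ : ∀ m, φ m = lam m • Q := fun m ↦ rfl
  have hφφ : ∀ m, φ (φ m) = 0 := fun m ↦ by rw [hφ, hφ, map_smul, hlamQ, smul_eq_mul, mul_zero, zero_smul]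
  let g : M ≃+ M :=
    { toFun := fun m ↦ m + φ m
      invFun := fun m ↦ m - φ m
      left_inv := fun m ↦ by
        change m + φ m - φ (m + φ m) = m
        rw [map_add, hφφ, add_zero, add_sub_cancel_right]
      right_inv := fun m ↦ by
        change m - φ m + φ (m - φ m) = m
        rw [map_sub, hφφ, sub_zero, sub_add_cancel]
      map_add' := fun a b ↦ by
        rw [map_add]
        abel }
  have hgQ : g Q = Q := by
    change Q + φ Q = Q
    rw [hφ, hlamQ, zero_smul, add_zero]
  have hgαQ : g (α Q) = α Q + Q := by
    change α Q + φ (α Q) = α Q + Q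
    rw [hφ, hlamαQ, one_smul]
  have hggαQ : g (g (α Q)) = α Q + Q + Q := by
    rw [hgαQ]
    change α Q + Q + φ (α Q + Q) = α Q + Q + Q
    rw [map_add, hφ, hφ, hlamαQ, hlamQ, one_smul, zero_smul, add_zero]
  have key := hcomm g Q
  rw [hgQ, hgQ, hggαQ, add_assoc, left_eq_add, ← two_smul (ZMod p)] at key
  have h2 : (2 : ZMod p) ≠ 0 := by
    intro h2
    have : ((2 : ℕ) : ZMod p) = 0 := by exact_mod_cast h2
    rw [ZMod.natCast_eq_zero_iff] at this
    exact hp2 ((Nat.prime_dvd_prime_iff_eq hp.out Nat.prime_two).mp this)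
  have hQ0 : Q = 0 := (smul_eq_zero.mp key).resolve_left h2
  exact hQ ⟨0, by rw [hQ0, map_zero, smul_zero]⟩

/-- **An additive endomorphism all of whose vectors are eigenvectors is a scalar.** [folklore] -/
theorem exists_forall_eq_smul_of_forall_exists (α : M →+ M) (h : ∀ Q : M, ∃ a : ZMod p, α Q = a • Q) :
    ∃ a : ZMod p, ∀ m : M, α m = a • m := by
  by_cases hM : ∀ m : M, m = 0
  · exact ⟨0, fun m ↦ by rw [hM m, map_zero, smul_zero]⟩
  obtain ⟨P₀, hP₀⟩ := not_forall.mp hM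
  obtain ⟨a, ha⟩ := h P₀
  refine ⟨a, fun m ↦ ?_⟩
  obtain ⟨b, hb⟩ := h m
  obtain ⟨c, hc⟩ := h (P₀ + m)
  rw [map_add, ha, hb, smul_add] at hc
  -- `(a - c) • P₀ = (c - b) • m`
  have hrel : (a - c) • P₀ = (c - b) • m := by
    rw [sub_smul, sub_smul, sub_eq_sub_iff_add_eq_add, add_comm (c • m) (c • P₀)]
    exact hc
  by_cases hcb : c = b
  · rw [hcb, sub_self, zero_smul, smul_eq_zero, sub_eq_zero] at hrel
    rcases hrel with hac | h0
    · rw [hb, hac]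
    · exact absurd h0 hP₀
  · -- `m ∈ 𝔽_p P₀`, so `α m = a • m`
    have hcb' : c - b ≠ 0 := sub_ne_zero.mpr hcb
    have hm : m = ((c - b)⁻¹ * (a - c)) • P₀ := by
      rw [mul_smul, hrel, ← mul_smul, inv_mul_cancel₀ hcb', one_smul]
    rw [hm, map_zmod_smul, ha, ← mul_smul, ← mul_smul, mul_comm]

end LinearAlgebra

/-! ## §2 Endomorphisms of `E[p](ℚ̄)` commuting with `Γ_K`, `[K : ℚ] = 2`, under `ρ̄` onto: scalars -/

section Galois

open Field.absoluteGaloisGroup (toAlgEquiv)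

variable (K : Type) [Field K] [NumberField K] (W : WeierstrassCurve ℚ)

/-- **Schur for `ρ̄_{E,p}|_{Γ_K}`, `K` quadratic.** Let `ρ̄ : Γ_ℚ → Aut(W[n](ℚ̄))` be onto (`n = p`: `#W[n] = p²`, `p · W[n] = 0`,
`p` odd) and `[K : ℚ] = 2`. An additive endomorphism `α` of `W[n](ℚ̄)` commuting with `res(τ)` for every `τ ∈ Γ_K` is a scalar:
`α = a • id` for some `a : ℕ`. (Every `g ∈ Aut(W[n])` is `ρ̄(σ)`, and `σ² = res(τ)` — `exists_resGal_eq_mul_self` —, so `α`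
commutes with all `g²`; §1.) [cite: Serre1972, §4] [cite: SerreGaloisCohomology1997, II §1.1] -/
theorem exists_forall_eq_smul_of_resGal_comm (hK2 : Module.finrank ℚ K = 2) {p : ℕ} [Fact p.Prime] (hp2 : p ≠ 2)
    (n : ℤ) (hs : W.HasSurjectiveModNGaloisRep n) (htors : ∀ x : geomTorsion W n, p • x = 0)
    (α : geomTorsion W n →+ geomTorsion W n)
    (hα : ∀ (τ : absoluteGaloisGroup K) (P : geomTorsion W n), α (resGal (K := ℚ) K τ • P) = resGal (K := ℚ) K τ • α P) :
    ∃ a : ℕ, ∀ P : geomTorsion W n, α P = a • P := by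
  letI : Module (ZMod p) (geomTorsion W n) := AddCommGroup.zmodModule htors
  -- `α` commutes with the square of every automorphism
  have hcomm : ∀ (g : geomTorsion W n ≃+ geomTorsion W n) (m : geomTorsion W n), α (g (g m)) = g (g (α m)) := by
    intro g m
    obtain ⟨σ, hσ⟩ := (show Function.Surjective _ from hs) (Multiplicative.ofAdd g)
    have hgσ : ∀ R : geomTorsion W n, g R = σ • R := fun R ↦ by
      have h := WeierstrassCurve.galoisRepTorsion_apply (W := W) n σ R
      rw [hσ, toAdd_ofAdd] at h
      exact h
    obtain ⟨τ, hτ⟩ := exists_resGal_eq_mul_self K hK2 σ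
    rw [hgσ, hgσ, hgσ, hgσ, ← mul_smul, ← mul_smul, ← hτ, hα]
  obtain ⟨a, ha⟩ := exists_forall_eq_smul_of_forall_exists α
    (forall_exists_eq_smul_of_comm_sq hp2 α hcomm)
  exact ⟨a.val, fun P ↦ by rw [ha, ← ZMod.natCast_zmod_val a, Nat.cast_smul_eq_nsmul, ZMod.natCast_zmod_val]⟩

end Galois

end Summit.BirchSwinnertonDyer.BirchSwinnertonDyer.Theorems.AdditiveKoly.KummerDescent

end
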